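import Mathlib
import Summits.QuantumFields.YangMills.Theorems.CoarseStiffnessTailCappedCoarseStiffnessLLargeFieldCount

/-!
# Route `CoarseStiffnessTail` — THE CAPPED STIFFNESS SPLITS INTO ITS BULK PART AND ITS EDGE PART, file 1 of 2: the pointwise identity and the
# one-pair integral inequalities (lead's certificate, seat `ym-line-cst-p1` g8; helper on crux stmt-QuantumFields-25301)

Context.  The crux `CoarseStiffnessTail.CappedCoarseStiffnessL` (stmt-QuantumFields-25301) tilts the cut-off-`K` Gibbs law by the CAPPED STIFFNESS
of the level-`j` averaged plaquette field, `β_{K−j}·X_j`, `X_j = Σ_{a ∈ Plaq_j} min(|Ū^j(∂a) − 1|², θ(K−j)²)`.  Seat g5 (p635820/p636229) showed that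
the line's glue towards `UnitScaleTilt.HistoryTailL` (stmt-QuantumFields-19936) reads the tilt only through the window EDGE — the LARGE-FIELD COUNT
`N_j = #{a : θ(K−j) ≤ |Ū^j(∂a) − 1|}` — and g3 (p628112) that the typed crux also carries joint Gaussian control at every SUB-threshold deviation.
This file and its companion `…EdgeBulkFactorisation` make the two parts KERNEL-SEPARABLE with no interaction term.  HERE (definition-free; finite
sums, one pointwise identity, `e^{a}e^{b} ≤ ½(e^{2a} + e^{2b})`):

* §1 **`min_sq_eq_bulk_add_edge`**: `min(d², θ²) = d²·1[d < θ] + θ²·1[θ ≤ d]` (`0 ≤ d, θ`); summed, **`mul_capSum_eq_bulk_add_edge`**: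
  `β·X_j = β·Y_j + (βθ²)·N_j` with the SUB-THRESHOLD (bulk) STIFFNESS `Y_j := Σ_a |Ū^j(∂a) − 1|²·1[|Ū^j(∂a) − 1| < θ]`; `0 ≤ Y_j ≤ X_j`
  (**`bulkSum_mem`**), measurability, integrability of `e^{tY_j}`, `e^{tN_j}`;
* §2 one pair `(K, j)`: **`integral_exp_bulk_le`** (`∫e^{cβY_j} ≤ ∫e^{cβX_j}`, the mirror image of g5's `integral_exp_count_le`) and
  **`integral_exp_capSum_le_half_add`**: with `β_{K−j}θ(K−j)² = p(g_{K−j})²` (`beta_mul_θBal_sq`),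
  `∫ e^{c·β_{K−j}X_j} dGibbs_K ≤ ½·∫ e^{2c·β_{K−j}Y_j} dGibbs_K + ½·∫ e^{2c·p(g_{K−j})²N_j} dGibbs_K`.

The companion file turns these into `CappedCoarseStiffnessL ⇔ SubThresholdStiffness ∧ UniformLargeFieldCount` at statement level.

HONEST SCOPE.  Elementary identities and inequalities about the line's observables; NOTHING of Bałaban's estimates is proved; the crux 25301 and
`HistoryTailL` 19936 stay OPEN; `YM3TorusSU2` (rung R3, a RECORD rung, not the Clay statement) is NOT proved; the Yang–Mills mass gap is NOT touched.

References: T. Bałaban, CMP **102** (1985) 255–275 [Balaban1985UV3] ((1)–(3), (5) p.256, (7) p.257, (71) p.273).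
-/

noncomputable section

namespace Summit.QuantumFields.YangMills.Theorems.CoarseStiffnessTailEdgeBulk

open MeasureTheory ProbabilityTheory Finset
open Literature.MathematicalPhysics.QuantumFieldTheory
open Literature.MathematicalPhysics.QuantumFieldTheory.Balaban1983to89
open Literature.MathematicalPhysics.QuantumFieldTheory.Balaban1983to89.T3ContinuumYM3Torus
open Literature.MathematicalPhysics.QuantumFieldTheory.Balaban1983to89.T3UnitScaleTilt
open Literature.MathematicalPhysics.QuantumFieldTheory.Balaban1983to89.T3UnitLawDensityEML
open Literature.MathematicalPhysics.QuantumFieldTheory.Balaban1983to89.T3FinestHeightTail (beta_mul_θBal_sq)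
open Literature.MathematicalPhysics.QuantumFieldTheory.Balaban1983to89.T3MinimiserStabilityReduction (θBal_pos)
open Summit.QuantumFields.YangMills.Theorems.LargeFieldMassRefinementTailSubGaussianRung (measurable_dist1_iter)
open Summit.QuantumFields.YangMills.Theorems.CoarseStiffnessTailHistoryTailOfStiffness (measurable_capSum capSum_mem)
open Summit.QuantumFields.YangMills.Theorems.CoarseStiffnessTailLargeFieldCount (measurable_count count_mem)

/-! ## §1 The pointwise identity: capped square = bulk part + edge part -/

section Pointwise

/-- **CAPPED SQUARE = BULK + EDGE** (`0 ≤ d`, `0 ≤ θ`): `min(d², θ²) = d²·1[d < θ] + θ²·1[θ ≤ d]` — below the threshold the cap is inactive,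
at or above it the capped square is the constant `θ²`. [folklore] -/
theorem min_sq_eq_bulk_add_edge {d θ : ℝ} (hd : 0 ≤ d) (hθ : 0 ≤ θ) :
    min (d ^ 2) (θ ^ 2) = (if d < θ then d ^ 2 else 0) + θ ^ 2 * (if θ ≤ d then (1 : ℝ) else 0) := by
  by_cases h : θ ≤ d
  · rw [if_neg (not_lt.mpr h), if_pos h, zero_add, mul_one]
    exact min_eq_right (pow_le_pow_left₀ hθ h 2)
  · have h' : d < θ := lt_of_not_ge h
    rw [if_pos h', if_neg h, mul_zero, add_zero]
    exact min_eq_left (pow_le_pow_left₀ hd h'.le 2)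

/-- The bulk part is dominated by the capped square: `d²·1[d < θ] ≤ min(d², θ²)` (`0 ≤ d`). [folklore] -/
theorem bulk_le_min_sq {d θ : ℝ} (hd : 0 ≤ d) :
    (if d < θ then d ^ 2 else 0) ≤ min (d ^ 2) (θ ^ 2) := by
  split_ifs with h
  · exact le_min le_rfl (pow_le_pow_left₀ hd h.le 2)
  · exact le_min (sq_nonneg _) (sq_nonneg _)

variable (F : T3Family)

/-- The sub-threshold (bulk) stiffness `Y_j(U) = Σ_{a ∈ Plaq_j} |Ū^j(∂a) − 1|²·1[|Ū^j(∂a) − 1| < θ]` is measurable. [folklore] -/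
theorem measurable_bulkSum (K j : ℕ) (θ : ℝ) :
    Measurable fun U : GaugeField (F.P K) 0 (Matrix.specialUnitaryGroup (Fin 2) ℂ) =>
      ∑ a : Plaq (F.P K) j, (if GaugeGroup.dist1 (GaugeField.plaqHol
        (Averaging.iter (fun i => BlockAveraging.blockAvg (P := F.P K) (j := i) ℰp) j U) a) < θ then
        GaugeGroup.dist1 (GaugeField.plaqHol
          (Averaging.iter (fun i => BlockAveraging.blockAvg (P := F.P K) (j := i) ℰp) j U) a) ^ 2 else 0) := by
  refine Finset.measurable_sum _ fun a _ => ?_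
  exact Measurable.ite (measurableSet_lt (measurable_dist1_iter F K j a) measurable_const)
    ((measurable_dist1_iter F K j a).pow_const 2) measurable_const

/-- `0 ≤ Y_j(U) ≤ X_j(U)`: the bulk stiffness is nonnegative and dominated by the capped stiffness. [folklore] -/
theorem bulkSum_mem (K j : ℕ) (θ : ℝ) (U : GaugeField (F.P K) 0 (Matrix.specialUnitaryGroup (Fin 2) ℂ)) :
    0 ≤ ∑ a : Plaq (F.P K) j, (if GaugeGroup.dist1 (GaugeField.plaqHol
        (Averaging.iter (fun i => BlockAveraging.blockAvg (P := F.P K) (j := i) ℰp) j U) a) < θ then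
        GaugeGroup.dist1 (GaugeField.plaqHol
          (Averaging.iter (fun i => BlockAveraging.blockAvg (P := F.P K) (j := i) ℰp) j U) a) ^ 2 else 0) ∧
    ∑ a : Plaq (F.P K) j, (if GaugeGroup.dist1 (GaugeField.plaqHol
        (Averaging.iter (fun i => BlockAveraging.blockAvg (P := F.P K) (j := i) ℰp) j U) a) < θ then
        GaugeGroup.dist1 (GaugeField.plaqHol
          (Averaging.iter (fun i => BlockAveraging.blockAvg (P := F.P K) (j := i) ℰp) j U) a) ^ 2 else 0) ≤
      ∑ a : Plaq (F.P K) j, min (GaugeGroup.dist1 (GaugeField.plaqHol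
        (Averaging.iter (fun i => BlockAveraging.blockAvg (P := F.P K) (j := i) ℰp) j U) a) ^ 2) (θ ^ 2) := by
  constructor
  · exact Finset.sum_nonneg fun a _ => by split_ifs <;> positivity
  · exact Finset.sum_le_sum fun a _ => bulk_le_min_sq (GaugeGroup.dist1_nonneg _)

/-- **`β·X_j = β·Y_j + (βθ²)·N_j`** pointwise (`0 ≤ θ`): the capped stiffness of a level is its bulk stiffness plus `θ²` times its
large-field count. [folklore] -/
theorem mul_capSum_eq_bulk_add_edge (K j : ℕ) {θ : ℝ} (hθ : 0 ≤ θ) (β : ℝ)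
    (U : GaugeField (F.P K) 0 (Matrix.specialUnitaryGroup (Fin 2) ℂ)) :
    β * ∑ a : Plaq (F.P K) j, min (GaugeGroup.dist1 (GaugeField.plaqHol
        (Averaging.iter (fun i => BlockAveraging.blockAvg (P := F.P K) (j := i) ℰp) j U) a) ^ 2) (θ ^ 2) =
      β * ∑ a : Plaq (F.P K) j, (if GaugeGroup.dist1 (GaugeField.plaqHol
          (Averaging.iter (fun i => BlockAveraging.blockAvg (P := F.P K) (j := i) ℰp) j U) a) < θ then
          GaugeGroup.dist1 (GaugeField.plaqHol
            (Averaging.iter (fun i => BlockAveraging.blockAvg (P := F.P K) (j := i) ℰp) j U) a) ^ 2 else 0) +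
      β * θ ^ 2 * ∑ a : Plaq (F.P K) j, (if θ ≤ GaugeGroup.dist1 (GaugeField.plaqHol
          (Averaging.iter (fun i => BlockAveraging.blockAvg (P := F.P K) (j := i) ℰp) j U) a) then (1 : ℝ) else 0) := by
  have hsum : ∑ a : Plaq (F.P K) j, min (GaugeGroup.dist1 (GaugeField.plaqHol
        (Averaging.iter (fun i => BlockAveraging.blockAvg (P := F.P K) (j := i) ℰp) j U) a) ^ 2) (θ ^ 2) =
      ∑ a : Plaq (F.P K) j, (if GaugeGroup.dist1 (GaugeField.plaqHol
          (Averaging.iter (fun i => BlockAveraging.blockAvg (P := F.P K) (j := i) ℰp) j U) a) < θ then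
          GaugeGroup.dist1 (GaugeField.plaqHol
            (Averaging.iter (fun i => BlockAveraging.blockAvg (P := F.P K) (j := i) ℰp) j U) a) ^ 2 else 0) +
      θ ^ 2 * ∑ a : Plaq (F.P K) j, (if θ ≤ GaugeGroup.dist1 (GaugeField.plaqHol
          (Averaging.iter (fun i => BlockAveraging.blockAvg (P := F.P K) (j := i) ℰp) j U) a) then (1 : ℝ) else 0) := by
    rw [Finset.mul_sum, ← Finset.sum_add_distrib]
    exact Finset.sum_congr rfl fun a _ => min_sq_eq_bulk_add_edge (GaugeGroup.dist1_nonneg _) hθ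
  rw [hsum]
  ring

end Pointwise

/-! ## §2 One cut-off, one height: domination of the bulk integral, and the `½(e^{2a} + e^{2b})` split of the capped-stiffness integral -/

section OnePair

variable (F : T3Family)

/-- `β_i = (γL^{−i})⁻¹ > 0` for `γ > 0`. [cite: Balaban1985UV3, (1)-(3) p.256] -/
theorem beta_pos {γ : ℝ} (hγ : 0 < γ) (i : ℕ) : 0 < (γ * ((F.L : ℝ)⁻¹) ^ i)⁻¹ := by
  have hL0 : (0 : ℝ) < F.L := by exact_mod_cast (zero_lt_one.trans F.hL.2)
  exact inv_pos.mpr (mul_pos hγ (pow_pos (inv_pos.mpr hL0) _))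

/-- Integrability of `exp(t·Y_j)` for `t ≥ 0` (bounded by `exp(t·#Plaq_j·θ²)` on a probability space). [folklore] -/
theorem integrable_exp_bulk {γ : ℝ} (hγ : 0 ≤ γ) (K j : ℕ) (θ : ℝ) {t : ℝ} (ht : 0 ≤ t) :
    Integrable (fun U : GaugeField (F.P K) 0 (Matrix.specialUnitaryGroup (Fin 2) ℂ) =>
      Real.exp (t * ∑ a : Plaq (F.P K) j, (if GaugeGroup.dist1 (GaugeField.plaqHol
        (Averaging.iter (fun i => BlockAveraging.blockAvg (P := F.P K) (j := i) ℰp) j U) a) < θ then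
        GaugeGroup.dist1 (GaugeField.plaqHol
          (Averaging.iter (fun i => BlockAveraging.blockAvg (P := F.P K) (j := i) ℰp) j U) a) ^ 2 else 0)))
      (gibbsK F ℰp γ K) := by
  haveI := isProbabilityMeasure_gibbsK F ℰp hγ K
  refine (integrable_const (Real.exp (t * ((Fintype.card (Plaq (F.P K) j) : ℝ) * θ ^ 2)))).mono'
    (Real.measurable_exp.comp ((measurable_bulkSum F K j θ).const_mul t)).aestronglyMeasurable (ae_of_all _ fun U => ?_)
  rw [Real.norm_eq_abs, abs_of_pos (Real.exp_pos _)]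
  exact Real.exp_le_exp.mpr (mul_le_mul_of_nonneg_left (((bulkSum_mem F K j θ U).2.trans (capSum_mem F K j θ U).2)) ht)

/-- Integrability of `exp(t·N_j)` for `t ≥ 0` (bounded by `exp(t·#Plaq_j)` on a probability space). [folklore] -/
theorem integrable_exp_count {γ : ℝ} (hγ : 0 ≤ γ) (K j : ℕ) (θ : ℝ) {t : ℝ} (ht : 0 ≤ t) :
    Integrable (fun U : GaugeField (F.P K) 0 (Matrix.specialUnitaryGroup (Fin 2) ℂ) =>
      Real.exp (t * ∑ a : Plaq (F.P K) j, (if θ ≤ GaugeGroup.dist1 (GaugeField.plaqHol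
        (Averaging.iter (fun i => BlockAveraging.blockAvg (P := F.P K) (j := i) ℰp) j U) a) then (1 : ℝ) else 0)))
      (gibbsK F ℰp γ K) := by
  haveI := isProbabilityMeasure_gibbsK F ℰp hγ K
  refine (integrable_const (Real.exp (t * (Fintype.card (Plaq (F.P K) j) : ℝ)))).mono'
    (Real.measurable_exp.comp ((measurable_count F K j θ).const_mul t)).aestronglyMeasurable (ae_of_all _ fun U => ?_)
  rw [Real.norm_eq_abs, abs_of_pos (Real.exp_pos _)]
  exact Real.exp_le_exp.mpr (mul_le_mul_of_nonneg_left (count_mem F K j θ U).2 ht)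

/-- **CAPPED STIFFNESS DOMINATES THE BULK STIFFNESS** (one family, `γ ≥ 0`, `0 ≤ c`, one cut-off `K`, one height `j`, any `β ≥ 0`, `θ`):
`∫ exp(c·β·Y_j) dGibbs_K ≤ ∫ exp(c·β·X_j) dGibbs_K` — §1 `bulkSum_mem`; the larger integrand is bounded, hence integrable. [folklore] -/
theorem integral_exp_bulk_le {γ c β : ℝ} (hγ : 0 ≤ γ) (hc : 0 ≤ c) (hβ : 0 ≤ β) (K j : ℕ) (θ : ℝ) :
    ∫ U, Real.exp (c * β * ∑ a : Plaq (F.P K) j, (if GaugeGroup.dist1 (GaugeField.plaqHol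
        (Averaging.iter (fun i => BlockAveraging.blockAvg (P := F.P K) (j := i) ℰp) j U) a) < θ then
        GaugeGroup.dist1 (GaugeField.plaqHol
          (Averaging.iter (fun i => BlockAveraging.blockAvg (P := F.P K) (j := i) ℰp) j U) a) ^ 2 else 0))
        ∂(gibbsK F ℰp γ K) ≤
      ∫ U, Real.exp (c * β * ∑ a : Plaq (F.P K) j, min (GaugeGroup.dist1 (GaugeField.plaqHol
        (Averaging.iter (fun i => BlockAveraging.blockAvg (P := F.P K) (j := i) ℰp) j U) a) ^ 2) (θ ^ 2))
        ∂(gibbsK F ℰp γ K) := by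
  haveI := isProbabilityMeasure_gibbsK F ℰp hγ K
  have hint : Integrable (fun U => Real.exp (c * β * ∑ a : Plaq (F.P K) j, min (GaugeGroup.dist1 (GaugeField.plaqHol
      (Averaging.iter (fun i => BlockAveraging.blockAvg (P := F.P K) (j := i) ℰp) j U) a) ^ 2) (θ ^ 2))) (gibbsK F ℰp γ K) := by
    refine (integrable_const (Real.exp (c * β * ((Fintype.card (Plaq (F.P K) j) : ℝ) * θ ^ 2)))).mono'
      (Real.measurable_exp.comp ((measurable_capSum F K j θ).const_mul (c * β))).aestronglyMeasurable (ae_of_all _ fun U => ?_)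
    rw [Real.norm_eq_abs, abs_of_pos (Real.exp_pos _)]
    exact Real.exp_le_exp.mpr (mul_le_mul_of_nonneg_left (capSum_mem F K j θ U).2 (mul_nonneg hc hβ))
  refine integral_mono_of_nonneg (ae_of_all _ fun U => (Real.exp_pos _).le) hint (ae_of_all _ fun U => ?_)
  exact Real.exp_le_exp.mpr (mul_le_mul_of_nonneg_left (bulkSum_mem F K j θ U).2 (mul_nonneg hc hβ))

/-- **THE SPLIT OF THE CAPPED-STIFFNESS INTEGRAL** (one family, `0 < γ ≤ 1`, `0 < b₀`, `0 ≤ c`, one cut-off `K`, one height `j`): with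
`β = β_{K−j}`, `θ = θ(K−j)` and `βθ² = p(g_{K−j})²` (`beta_mul_θBal_sq`),
`∫ e^{c·β·X_j} dGibbs_K ≤ ½·∫ e^{2c·β·Y_j} dGibbs_K + ½·∫ e^{2c·p(g_{K−j})²·N_j} dGibbs_K` — pointwise `β X_j = β Y_j + p² N_j` (§1) and
`e^{a}·e^{b} ≤ ½(e^{2a} + e^{2b})`. [folklore] -/
theorem integral_exp_capSum_le_half_add {γ b₀ p₀ c : ℝ} (hγ : 0 < γ) (hγ1 : γ ≤ 1) (hb₀ : 0 < b₀) (hc : 0 ≤ c) (K j : ℕ) :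
    ∫ U, Real.exp (c * (γ * ((F.L : ℝ)⁻¹) ^ (K - j))⁻¹ *
        ∑ a : Plaq (F.P K) j, min (GaugeGroup.dist1 (GaugeField.plaqHol
          (Averaging.iter (fun i => BlockAveraging.blockAvg (P := F.P K) (j := i) ℰp) j U) a) ^ 2)
          (θBal F.L γ b₀ p₀ (K - j) ^ 2)) ∂(gibbsK F ℰp γ K) ≤
      (1 / 2) * ∫ U, Real.exp (2 * c * (γ * ((F.L : ℝ)⁻¹) ^ (K - j))⁻¹ *
        ∑ a : Plaq (F.P K) j, (if GaugeGroup.dist1 (GaugeField.plaqHol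
          (Averaging.iter (fun i => BlockAveraging.blockAvg (P := F.P K) (j := i) ℰp) j U) a) < θBal F.L γ b₀ p₀ (K - j) then
          GaugeGroup.dist1 (GaugeField.plaqHol
            (Averaging.iter (fun i => BlockAveraging.blockAvg (P := F.P K) (j := i) ℰp) j U) a) ^ 2 else 0))
          ∂(gibbsK F ℰp γ K) +
      (1 / 2) * ∫ U, Real.exp (2 * c * B10.pFun b₀ p₀ (Real.sqrt (γ * ((F.L : ℝ)⁻¹) ^ (K - j))) ^ 2 *
        ∑ a : Plaq (F.P K) j, (if θBal F.L γ b₀ p₀ (K - j) ≤ GaugeGroup.dist1 (GaugeField.plaqHol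
          (Averaging.iter (fun i => BlockAveraging.blockAvg (P := F.P K) (j := i) ℰp) j U) a) then (1 : ℝ) else 0))
          ∂(gibbsK F ℰp γ K) := by
  haveI := isProbabilityMeasure_gibbsK F ℰp hγ.le K
  have hL : 1 ≤ F.L := F.hL.2.le
  set θ : ℝ := θBal F.L γ b₀ p₀ (K - j) with hθdef
  have hθ0 : 0 < θ := θBal_pos hL hγ hγ1 hb₀ p₀ (K - j)
  set β : ℝ := (γ * ((F.L : ℝ)⁻¹) ^ (K - j))⁻¹ with hβdef
  have hβ0 : 0 < β := beta_pos F hγ (K - j)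
  have hβeq : (F.scheme ℰp γ).β (K - j) = β := rfl
  have hp2 : B10.pFun b₀ p₀ (Real.sqrt (γ * ((F.L : ℝ)⁻¹) ^ (K - j))) ^ 2 = β * θ ^ 2 := by
    rw [← hβeq, hθdef, beta_mul_θBal_sq F hγ b₀ p₀ (K - j)]
  rw [hp2]
  -- abbreviations for the three observables
  set X : GaugeField (F.P K) 0 (Matrix.specialUnitaryGroup (Fin 2) ℂ) → ℝ := fun U =>
    ∑ a : Plaq (F.P K) j, min (GaugeGroup.dist1 (GaugeField.plaqHol
      (Averaging.iter (fun i => BlockAveraging.blockAvg (P := F.P K) (j := i) ℰp) j U) a) ^ 2) (θ ^ 2) with hXdef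
  set Y : GaugeField (F.P K) 0 (Matrix.specialUnitaryGroup (Fin 2) ℂ) → ℝ := fun U =>
    ∑ a : Plaq (F.P K) j, (if GaugeGroup.dist1 (GaugeField.plaqHol
      (Averaging.iter (fun i => BlockAveraging.blockAvg (P := F.P K) (j := i) ℰp) j U) a) < θ then
      GaugeGroup.dist1 (GaugeField.plaqHol
        (Averaging.iter (fun i => BlockAveraging.blockAvg (P := F.P K) (j := i) ℰp) j U) a) ^ 2 else 0) with hYdef
  set N : GaugeField (F.P K) 0 (Matrix.specialUnitaryGroup (Fin 2) ℂ) → ℝ := fun U =>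
    ∑ a : Plaq (F.P K) j, (if θ ≤ GaugeGroup.dist1 (GaugeField.plaqHol
      (Averaging.iter (fun i => BlockAveraging.blockAvg (P := F.P K) (j := i) ℰp) j U) a) then (1 : ℝ) else 0) with hNdef
  -- the pointwise bound `e^{cβX} ≤ ½ e^{2cβY} + ½ e^{2cβθ²N}`
  have hpt : ∀ U, Real.exp (c * β * X U) ≤
      (1 / 2) * Real.exp (2 * c * β * Y U) + (1 / 2) * Real.exp (2 * c * (β * θ ^ 2) * N U) := by
    intro U
    have hsplit : c * β * X U = c * β * Y U + c * (β * θ ^ 2) * N U := by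
      have h := mul_capSum_eq_bulk_add_edge F K j hθ0.le β U
      simp only [hXdef, hYdef, hNdef]
      calc c * β * X U = c * (β * X U) := by ring
        _ = c * (β * Y U + β * θ ^ 2 * N U) := by rw [h]
        _ = c * β * Y U + c * (β * θ ^ 2) * N U := by ring
    rw [hsplit, Real.exp_add]
    have h2 := two_mul_le_add_sq (Real.exp (c * β * Y U)) (Real.exp (c * (β * θ ^ 2) * N U))
    rw [← Real.exp_nat_mul, ← Real.exp_nat_mul] at h2
    push_cast at h2
    have e1 : (2 : ℝ) * (c * β * Y U) = 2 * c * β * Y U := by ring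
    have e2 : (2 : ℝ) * (c * (β * θ ^ 2) * N U) = 2 * c * (β * θ ^ 2) * N U := by ring
    rw [e1, e2] at h2
    linarith
  -- integrate
  have hc2 : 0 ≤ 2 * c := by positivity
  have hintY : Integrable (fun U => Real.exp (2 * c * β * Y U)) (gibbsK F ℰp γ K) := by
    have h := integrable_exp_bulk F hγ.le K j θ (mul_nonneg hc2 hβ0.le)
    simpa only [hYdef] using h
  have hintN : Integrable (fun U => Real.exp (2 * c * (β * θ ^ 2) * N U)) (gibbsK F ℰp γ K) := by
    have h := integrable_exp_count F hγ.le K j θ (mul_nonneg hc2 (mul_nonneg hβ0.le (sq_nonneg θ)))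
    simpa only [hNdef] using h
  have hintR : Integrable (fun U => (1 / 2) * Real.exp (2 * c * β * Y U) + (1 / 2) * Real.exp (2 * c * (β * θ ^ 2) * N U))
      (gibbsK F ℰp γ K) := (hintY.const_mul _).add (hintN.const_mul _)
  calc ∫ U, Real.exp (c * β * X U) ∂(gibbsK F ℰp γ K)
      ≤ ∫ U, ((1 / 2) * Real.exp (2 * c * β * Y U) + (1 / 2) * Real.exp (2 * c * (β * θ ^ 2) * N U)) ∂(gibbsK F ℰp γ K) :=
        integral_mono_of_nonneg (ae_of_all _ fun U => (Real.exp_pos _).le) hintR (ae_of_all _ fun U => hpt U)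
    _ = (1 / 2) * ∫ U, Real.exp (2 * c * β * Y U) ∂(gibbsK F ℰp γ K) +
          (1 / 2) * ∫ U, Real.exp (2 * c * (β * θ ^ 2) * N U) ∂(gibbsK F ℰp γ K) := by
        rw [integral_add (hintY.const_mul _) (hintN.const_mul _), integral_const_mul, integral_const_mul]

end OnePair

end Summit.QuantumFields.YangMills.Theorems.CoarseStiffnessTailEdgeBulk

end
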